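import Literature.Analysis.FluidPDE.FluidComputer.LocalCircuit
import HarnessLib

/-!
# Fluid computer blueprint — the LOCAL layer, II: the bootstrap (whole-tick shadowing and leakage are theorems)

HONEST FRAMING: low prior, high value-of-information experiment on Tao's machine paradigm; NOT a
claim that NS blows up. Nothing in this file constructs a design; every theorem is an implication
from the structure `LocalCircuit S O s` of `LocalCircuit.lean`, which, as far as anyone knows, is
uninhabited for the true equations.

`LocalCircuit.lean` typed a circuit design for Tao's machine (J. Amer. Math. Soc. 29 (2016), §1.3)
whose two dynamical axioms are INSTANTANEOUS and GUARDED — `defect` (while the state is in the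
generation-`n` working region, the readout's right derivative in rescaled units is `ε`-close to the
design vector field `F`) and `junk_rate` (meanwhile the junk's lower right Dini derivative is
`≤ γ √E_n / unit n`) — and proved the two GUARDED estimates: `dist_le_gronwallBound_of_guard`
(Grönwall for `ε`-approximate trajectories, rescaled time) and `junk_toReal_le_of_guard` (a Dini
fence). This file closes the guard:

* `LocalCircuit.shadow_leak_sharp` — THE BOOTSTRAP (continuous induction over one tick, in
  physical time): along every `H¹⁰_df`-mild Navier–Stokes trajectory loaded at generation `n` at
  time `t` (`read n (u t) ∈ Ain`, `junk n (u t) ≤ jin √E_n`), for every rescaled `σ ∈ [0, τc]`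
  inside the lifespan, the readout is within `gronwallBound 0 L ε σ = ε (e^{Lσ} - 1)/L` of the
  circuit orbit AND the junk is `≤ (jin + γ σ) √E_n`. The set of physical times where both hold is
  closed (readout and junk are continuous along the trajectory — the latter because junk is measured
  in `X^s_{λ_n}`, `s ≤ 10`, along an `H¹⁰`-continuous path), contains `t`, and propagates to the
  right: both bounds place the state in the working region (`gronwallBound ≤ δsh` + `tube`;
  `jin + γ τc ≤ jrun < jbar`), the working region is OPEN, so by continuity the state stays in it a
  little longer, and there the guarded estimates re-prove both bounds
  (`IsClosed.Icc_subset_of_forall_mem_nhdsGT_of_Icc_subset`).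
* `LocalCircuit.shadow`, `LocalCircuit.leak` — the whole-tick, unguarded axioms of
  `ShadowedCircuit`, now theorems; `LocalCircuit.toShadowedCircuit : ShadowedCircuit S O s`.
  Everything downstream (realisation as a pump cascade, self-replication, explicit noise tolerance,
  liveness given `H10Control`, finite lifespan `≤ T_*` for `α > 0`, `η > 1/4`) follows by the
  architecture layer.
* `LocalCircuit.dist_read_le_exp` — the quantitative gain: the readout error after rescaled time
  `σ` is `≤ ε σ e^{Lσ}`, small early in the tick ("the machine is seen computing before the error
  budget is spent"), which a whole-tick axiom cannot express.

Honest ceiling: unchanged from `LocalCircuit.lean` — the burden now sits in two scalar, local,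
DNS-measurable inequalities (`defect`, `junk_rate`) about the true flow near a finite-dimensional
design, plus finite-dimensional certificates; nothing here asserts them. [cite: Tao2016AveragedNS, §1.3 pp. 10–11]
-/

noncomputable section

open MeasureTheory Set Filter Topology
open scoped ENNReal NNReal SchwartzMap

namespace Literature.Analysis.FluidPDE.FluidComputer

open Literature.Analysis.FluidPDE.Tao2016
open Literature.Analysis.FunctionSpaces (eFourierSobolevNorm)

namespace LocalCircuit

variable {S : CascadeSpecs} {O : Type*} [NormedAddCommGroup O] [NormedSpace ℝ O] {s : ℝ}
  (A : LocalCircuit S O s)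

/-! ### §5. The bootstrap: the guarded estimates close the guard -/

/-- **SHARP SHADOWING AND LEAKAGE over a whole cycle** (the bootstrap). Along every `H¹⁰_df`-mild
Navier–Stokes trajectory LOADED at generation `n` at time `t ≥ 0` (`read n (u t) ∈ Ain`,
`junk n (u t) ≤ jin √E_n`), for every rescaled `σ ∈ [0, τc]` with `t + unit n · σ` inside the
lifespan: the readout is within `gronwallBound 0 L ε σ` of the circuit orbit of the initial readout
AND the junk is at most `(jin + γ σ) √E_n`. Proof: continuous induction on physical time over
`[t, t + unit n · σ]` for the set where both bounds hold — it is closed (readout and junk are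
continuous along the trajectory), holds at `t` (`flow_zero`), and from `[t, x]` it propagates past
`x`: the bounds put the state in the working region on `[t, x]` (`gronwallBound ≤ δsh` + `tube`;
`jin + γ τc ≤ jrun < jbar`), the working region is open so the state stays in it a little longer
(continuity), and on any such stretch the guarded estimates `dist_le_gronwallBound_of_guard` /
`junk_toReal_le_of_guard` re-establish both bounds. [folklore] -/
theorem shadow_leak_sharp (n : ℕ) (a : L2C) (S' : ℝ) (u : ℝ → L2C)
    (hu : IsMildSolutionFor eulerForm a (Ico 0 S') u) (t : ℝ) (ht : 0 ≤ t)
    (hin : A.read n (u t) ∈ A.Ain)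
    (hj : A.junk n (u t) ≤ ENNReal.ofReal (A.jin * Real.sqrt (S.Emin n)))
    (σ : ℝ) (hσ0 : 0 ≤ σ) (hστ : σ ≤ A.τc) (hlt : t + A.unit n * σ < S') :
    dist (A.read n (u (t + A.unit n * σ))) (A.Φ σ (A.read n (u t))) ≤
        gronwallBound 0 (A.L : ℝ) A.ε σ ∧
      A.junk n (u (t + A.unit n * σ)) ≤
        ENNReal.ofReal ((A.jin + A.γ * σ) * Real.sqrt (S.Emin n)) := by
  have hun := A.unit_pos n
  have hE : 0 < Real.sqrt (S.Emin n) := Real.sqrt_pos.2 (S.Emin_pos n)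
  set p : O := A.read n (u t) with hp
  set T₁ : ℝ := t + A.unit n * σ with hT₁
  have htT₁ : t ≤ T₁ := le_add_of_nonneg_right (mul_nonneg hun.le hσ0)
  have hI : Icc t T₁ ⊆ Ico 0 S' := fun y hy => ⟨ht.trans hy.1, hy.2.trans_lt hlt⟩
  have htI : t ∈ Ico 0 S' := hI ⟨le_rfl, htT₁⟩
  -- rescaled time elapsed since `t`
  set τ : ℝ → ℝ := fun x => (x - t) / A.unit n with hτ
  have hτx : ∀ x, t + A.unit n * τ x = x := fun x => by
    simp only [hτ]; rw [mul_comm, div_mul_cancel₀ _ hun.ne']; ring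
  have hτt : τ t = 0 := by simp [hτ]
  have hτT₁ : τ T₁ = σ := by
    simp only [hτ, hT₁, add_sub_cancel_left, mul_div_cancel_left₀ σ hun.ne']
  have hτ_mono : ∀ x y, x ≤ y → τ x ≤ τ y := fun x y hxy =>
    div_le_div_of_nonneg_right (sub_le_sub_right hxy t) hun.le
  have hτ_le : ∀ x ∈ Icc t T₁, τ x ∈ Icc 0 σ := fun x hx =>
    ⟨div_nonneg (sub_nonneg.2 hx.1) hun.le, hτT₁ ▸ hτ_mono x T₁ hx.2⟩
  have hτc : Continuous τ := by simp only [hτ]; fun_prop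
  -- junk is finite along the trajectory; its real value
  have hfin : ∀ x ∈ Ico 0 S', A.junk n (u x) ≠ ⊤ := fun x hx =>
    A.junk_ne_top hu n htI (ne_top_of_le_ne_top ENNReal.ofReal_ne_top hj) hx
  set J : ℝ → ℝ := fun x => (A.junk n (u x)).toReal with hJ
  have hJt : J t ≤ A.jin * Real.sqrt (S.Emin n) :=
    ENNReal.toReal_le_of_le_ofReal (mul_pos (A.jcore_nonneg.trans_lt A.jcore_lt) hE).le hj
  -- the bootstrap set
  set B : Set ℝ := {x | dist (A.read n (u x)) (A.Φ (τ x) p) ≤ gronwallBound 0 (A.L : ℝ) A.ε (τ x) ∧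
    J x ≤ A.jin * Real.sqrt (S.Emin n) + A.γ * Real.sqrt (S.Emin n) * τ x} with hB
  -- (i) members of `B` in `[t, T₁]` are in the working region
  have hguard : ∀ x ∈ Icc t T₁, x ∈ B → A.Guard n (u x) := by
    intro x hx hxB
    have hτc' : τ x ∈ Icc 0 A.τc := ⟨(hτ_le x hx).1, (hτ_le x hx).2.trans hστ⟩
    refine ⟨A.tube p hin (τ x) hτc' (Metric.mem_closedBall.2 (hxB.1.trans (A.gronwallBound_le_δsh hτc'.2))), ?_⟩
    rw [← ENNReal.ofReal_toReal (hfin x (hI hx)), ENNReal.ofReal_lt_ofReal_iff (mul_pos A.jbar_pos hE)]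
    calc J x ≤ A.jin * Real.sqrt (S.Emin n) + A.γ * Real.sqrt (S.Emin n) * τ x := hxB.2
      _ ≤ A.jin * Real.sqrt (S.Emin n) + A.γ * Real.sqrt (S.Emin n) * A.τc :=
          add_le_add_right (mul_le_mul_of_nonneg_left hτc'.2 (mul_nonneg A.γ_nonneg hE.le)) _
      _ = (A.jin + A.γ * A.τc) * Real.sqrt (S.Emin n) := by ring
      _ ≤ A.jrun * Real.sqrt (S.Emin n) := mul_le_mul_of_nonneg_right A.jrun_ge hE.le
      _ < A.jbar * Real.sqrt (S.Emin n) := mul_lt_mul_of_pos_right A.jrun_lt_jbar hE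
  -- (ii) `B ∩ [t, T₁]` is closed
  have hclosed : IsClosed (B ∩ Icc t T₁) := by
    have hread : ContinuousOn (fun x => A.read n (u x)) (Icc t T₁) := (A.read_continuousOn hu n).mono hI
    have hflow : ContinuousOn (fun x => A.Φ (τ x) p) (Icc t T₁) :=
      (A.flow_cont p hin).comp hτc.continuousOn fun x hx => ⟨(hτ_le x hx).1, (hτ_le x hx).2.trans hστ⟩
    have hdist : ContinuousOn (fun x => dist (A.read n (u x)) (A.Φ (τ x) p)) (Icc t T₁) :=
      continuous_dist.comp_continuousOn (hread.prodMk hflow)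
    have hgB : Continuous fun x => gronwallBound 0 (A.L : ℝ) A.ε (τ x) :=
      (continuous_iff_continuousAt.2 fun y =>
        (hasDerivAt_gronwallBound 0 (A.L : ℝ) A.ε y).continuousAt).comp hτc
    have hJc : ContinuousOn J (Icc t T₁) := fun y hy =>
      (A.junk_toReal_continuousWithinAt hu n (hI hy) (hfin y (hI hy))).mono hI
    have hrhs : Continuous fun x => A.jin * Real.sqrt (S.Emin n) + A.γ * Real.sqrt (S.Emin n) * τ x := by
      fun_prop
    have h1 := hdist.prodMk hgB.continuousOn |>.preimage_isClosed_of_isClosed isClosed_Icc isClosed_le_prod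
    have h2 := hJc.prodMk hrhs.continuousOn |>.preimage_isClosed_of_isClosed isClosed_Icc isClosed_le_prod
    have hEq : B ∩ Icc t T₁ =
        (Icc t T₁ ∩ (fun x => (dist (A.read n (u x)) (A.Φ (τ x) p), gronwallBound 0 (A.L : ℝ) A.ε (τ x))) ⁻¹'
            {q : ℝ × ℝ | q.1 ≤ q.2}) ∩
          (Icc t T₁ ∩ (fun x => (J x, A.jin * Real.sqrt (S.Emin n) + A.γ * Real.sqrt (S.Emin n) * τ x)) ⁻¹'
            {q : ℝ × ℝ | q.1 ≤ q.2}) := by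
      ext x
      simp only [hB, mem_inter_iff, mem_setOf_eq, mem_preimage]
      tauto
    rw [hEq]
    exact h1.inter h2
  -- (iii) `t ∈ B`
  have htB : t ∈ B := by
    refine ⟨?_, ?_⟩
    · rw [hτt, A.flow_zero p hin, gronwallBound_x0, hp, dist_self]
    · rw [hτt, mul_zero, add_zero]; exact hJt
  -- (iv) continuous induction
  have hmain : Icc t T₁ ⊆ B := by
    refine hclosed.Icc_subset_of_forall_mem_nhdsGT_of_Icc_subset htB fun x hx hxB => ?_
    have hxI : x ∈ Ico 0 S' := hI ⟨hx.1, hx.2.le⟩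
    -- the working region on `[t, x]`
    have hG1 : ∀ y ∈ Icc t x, A.Guard n (u y) := fun y hy =>
      hguard y ⟨hy.1, hy.2.trans hx.2.le⟩ (hxB hy)
    -- … and, by openness and continuity, on `[x, m)` for some `m ∈ (x, T₁]`
    obtain ⟨m, hxm, hmT, hG2⟩ : ∃ m, x < m ∧ m ≤ T₁ ∧ ∀ y ∈ Ico x m, A.Guard n (u y) := by
      have hGx := hG1 x ⟨hx.1, le_rfl⟩
      have h1 : ∀ᶠ y in 𝓝[Ico 0 S'] x, A.read n (u y) ∈ A.U :=
        Filter.Tendsto.eventually_mem ((A.read_continuousOn hu n) x hxI) (A.U_open.mem_nhds hGx.1)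
      have h2 : ∀ᶠ y in 𝓝[Ico 0 S'] x,
          A.junk n (u y) < ENNReal.ofReal (A.jbar * Real.sqrt (S.Emin n)) :=
        Filter.Tendsto.eventually_mem (A.junk_tendsto hu n hxI (hfin x hxI)) (Iio_mem_nhds hGx.2)
      obtain ⟨η, hη, hball⟩ := Metric.eventually_nhds_iff.1 (eventually_nhdsWithin_iff.1 (h1.and h2))
      refine ⟨min (x + η) T₁, lt_min (by linarith) hx.2, min_le_right _ _, fun y hy => ?_⟩
      have hy1 : y < x + η := (lt_min_iff.1 hy.2).1
      have hy2 : y < T₁ := (lt_min_iff.1 hy.2).2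
      have hyx : dist y x < η := by
        rw [Real.dist_eq, abs_of_nonneg (sub_nonneg.2 hy.1)]; linarith
      exact hball hyx ⟨(ht.trans hx.1).trans hy.1, hy2.trans hlt⟩
    -- so every `y ∈ (x, m)` is in `B`
    have hIoo : Ioo x m ⊆ B := by
      intro y hy
      have hyT : y ≤ T₁ := hy.2.le.trans hmT
      have hty : t ≤ y := hx.1.trans hy.1.le
      have hyS : y < S' := (hy.2.trans_le hmT).trans hlt
      have hGy : ∀ z ∈ Ico t y, A.Guard n (u z) := by
        intro z hz
        rcases le_or_gt z x with hzx | hxz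
        · exact hG1 z ⟨hz.1, hzx⟩
        · exact hG2 z ⟨hxz.le, hz.2.trans hy.2⟩
      have hτy : τ y ∈ Icc 0 σ := hτ_le y ⟨hty, hyT⟩
      refine ⟨?_, ?_⟩
      · have hS'y : t + A.unit n * τ y < S' := by rw [hτx]; exact hyS
        have hGy' : ∀ z ∈ Ico t (t + A.unit n * τ y), A.Guard n (u z) := by rw [hτx]; exact hGy
        have h := A.dist_le_gronwallBound_of_guard hu n ht hin (hτy.2.trans hστ) hS'y hGy' (τ y)
          ⟨hτy.1, le_rfl⟩
        rwa [hτx] at h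
      · have h := A.junk_toReal_le_of_guard hu n ht hyS (hfin t htI) hGy y ⟨hty, le_rfl⟩
        calc J y ≤ J t + A.γ * (Real.sqrt (S.Emin n) / A.unit n) * (y - t) := h
          _ = J t + A.γ * Real.sqrt (S.Emin n) * τ y := by simp only [hτ]; ring
          _ ≤ A.jin * Real.sqrt (S.Emin n) + A.γ * Real.sqrt (S.Emin n) * τ y :=
              add_le_add_left hJt _
    exact mem_of_superset (Ioo_mem_nhdsGT hxm) hIoo
  -- (v) read off at `T₁`
  have hT₁B := hmain ⟨htT₁, le_rfl⟩
  refine ⟨?_, ?_⟩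
  · have h := hT₁B.1
    rwa [hτT₁] at h
  · rw [← ENNReal.ofReal_toReal (hfin T₁ (hI ⟨htT₁, le_rfl⟩))]
    refine ENNReal.ofReal_le_ofReal ?_
    calc J T₁ ≤ A.jin * Real.sqrt (S.Emin n) + A.γ * Real.sqrt (S.Emin n) * τ T₁ := hT₁B.2
      _ = (A.jin + A.γ * σ) * Real.sqrt (S.Emin n) := by rw [hτT₁]; ring

/-- **SHARP SHADOWING**: a loaded trajectory's readout is within `gronwallBound 0 L ε σ`
(`= ε (e^{Lσ} - 1)/L`, growing from `0`) of the circuit orbit after rescaled time `σ ≤ τc`. [folklore] -/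
theorem shadow_sharp (n : ℕ) (a : L2C) (S' : ℝ) (u : ℝ → L2C)
    (hu : IsMildSolutionFor eulerForm a (Ico 0 S') u) (t : ℝ) (ht : 0 ≤ t)
    (hin : A.read n (u t) ∈ A.Ain)
    (hj : A.junk n (u t) ≤ ENNReal.ofReal (A.jin * Real.sqrt (S.Emin n)))
    (σ : ℝ) (hσ0 : 0 ≤ σ) (hστ : σ ≤ A.τc) (hlt : t + A.unit n * σ < S') :
    dist (A.read n (u (t + A.unit n * σ))) (A.Φ σ (A.read n (u t))) ≤
      gronwallBound 0 (A.L : ℝ) A.ε σ :=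
  (A.shadow_leak_sharp n a S' u hu t ht hin hj σ hσ0 hστ hlt).1

/-- **SHARP LEAKAGE**: a loaded trajectory's generation-`n` junk is at most `(jin + γ σ) √E_n`
after rescaled time `σ ≤ τc`. [folklore] -/
theorem leak_sharp (n : ℕ) (a : L2C) (S' : ℝ) (u : ℝ → L2C)
    (hu : IsMildSolutionFor eulerForm a (Ico 0 S') u) (t : ℝ) (ht : 0 ≤ t)
    (hin : A.read n (u t) ∈ A.Ain)
    (hj : A.junk n (u t) ≤ ENNReal.ofReal (A.jin * Real.sqrt (S.Emin n)))
    (σ : ℝ) (hσ0 : 0 ≤ σ) (hστ : σ ≤ A.τc) (hlt : t + A.unit n * σ < S') :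
    A.junk n (u (t + A.unit n * σ)) ≤ ENNReal.ofReal ((A.jin + A.γ * σ) * Real.sqrt (S.Emin n)) :=
  (A.shadow_leak_sharp n a S' u hu t ht hin hj σ hσ0 hστ hlt).2

/-- **SHADOWING (`ShadowedCircuit.shadow`) is a theorem of the local design**: within `δsh` of the
circuit orbit for the whole cycle, unguarded, up to lifespan. [cite: Tao2016AveragedNS, §1.3 pp. 10–11] -/
theorem shadow (n : ℕ) (a : L2C) (S' : ℝ) (u : ℝ → L2C)
    (hu : IsMildSolutionFor eulerForm a (Ico 0 S') u) (t : ℝ) (ht : 0 ≤ t)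
    (hin : A.read n (u t) ∈ A.Ain)
    (hj : A.junk n (u t) ≤ ENNReal.ofReal (A.jin * Real.sqrt (S.Emin n)))
    (σ : ℝ) (hσ0 : 0 ≤ σ) (hστ : σ ≤ A.τc) (hlt : t + A.unit n * σ < S') :
    dist (A.read n (u (t + A.unit n * σ))) (A.Φ σ (A.read n (u t))) ≤ A.δsh :=
  (A.shadow_sharp n a S' u hu t ht hin hj σ hσ0 hστ hlt).trans (A.gronwallBound_le_δsh hστ)

/-- **LEAKAGE (`ShadowedCircuit.leak`) is a theorem of the local design**: junk below the running
threshold `jrun √E_n` for the whole cycle, unguarded, up to lifespan. [cite: Tao2016AveragedNS, §1.3 pp. 10–11] -/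
theorem leak (n : ℕ) (a : L2C) (S' : ℝ) (u : ℝ → L2C)
    (hu : IsMildSolutionFor eulerForm a (Ico 0 S') u) (t : ℝ) (ht : 0 ≤ t)
    (hin : A.read n (u t) ∈ A.Ain)
    (hj : A.junk n (u t) ≤ ENNReal.ofReal (A.jin * Real.sqrt (S.Emin n)))
    (σ : ℝ) (hσ0 : 0 ≤ σ) (hστ : σ ≤ A.τc) (hlt : t + A.unit n * σ < S') :
    A.junk n (u (t + A.unit n * σ)) ≤ ENNReal.ofReal (A.jrun * Real.sqrt (S.Emin n)) :=
  (A.leak_sharp n a S' u hu t ht hin hj σ hσ0 hστ hlt).trans (ENNReal.ofReal_le_ofReal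
    (mul_le_mul_of_nonneg_right (A.jin_add_mul_le hστ) (Real.sqrt_nonneg _)))

/-! ### §5b. The two budget numbers a designer reads off -/

/-- **The price of abruptness** (the defect budget solved for `ε`): `ε τc (e^{Lτc} - 1) ≤ δsh · (L τc)`,
i.e. the admissible readout defect per unit rescaled time is `(δsh/τc) · A/(e^{A} - 1)` for the
rate–delay product `A = L τc` of the design (`A → 0`: `δsh/τc`; `A = 10`: `4.5·10⁻⁴ δsh/τc`;
`A = 20`: `4·10⁻⁸ δsh/τc`). [folklore] -/
theorem defect_budget_exp :
    A.ε * A.τc * (Real.exp (A.L * A.τc) - 1) ≤ A.δsh * (A.L * A.τc) := by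
  rcases eq_or_lt_of_le A.L.coe_nonneg with h0 | hL
  · rw [← h0]; simp
  · have h := A.δsh_ge
    simp only [gronwallBound_of_K_ne_0 hL.ne', zero_mul, zero_add] at h
    have h' := mul_le_mul_of_nonneg_right h (mul_nonneg hL.le A.τc_nonneg)
    calc A.ε * A.τc * (Real.exp (A.L * A.τc) - 1)
        = A.ε / A.L * (Real.exp (A.L * A.τc) - 1) * (A.L * A.τc) := by field_simp
      _ ≤ A.δsh * (A.L * A.τc) := h'

/-- **The leak budget solved for `γ`**: the junk may grow by at most `(jrun - jin) √E_n` per cycle,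
`γ τc ≤ jrun - jin`. [folklore] -/
theorem leak_budget : A.γ * A.τc ≤ A.jrun - A.jin := by linarith [A.jrun_ge]

/-! ### §6. The local design IS a shadowed circuit design -/

/-- **The shadowed circuit design of a local design**: all static / circuit / clock / seed fields
verbatim, and the two whole-tick dynamics axioms `shadow`, `leak` DISCHARGED by the bootstrap. Hence
everything downstream of `ShadowedCircuit`: realisation, self-replication, explicit noise tolerance
`ρ = min (δ/Λ) (jin - jcore)`, liveness given `H10Control`, finite lifespan `≤ T_*` for `α > 0`,
`η > 1/4`. [cite: Tao2016AveragedNS, §1.3 pp. 10–11] -/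
def toShadowedCircuit : ShadowedCircuit S O s where
  read := A.read
  recon := A.recon
  junk := A.junk
  Λ := A.Λ
  Λ_pos := A.Λ_pos
  read_lip := A.read_lip
  junk_perturb := A.junk_perturb
  read_recon := A.read_recon
  junk_recon := A.junk_recon
  Ain := A.Ain
  Acore := A.Acore
  Aout := A.Aout
  δ := A.δ
  δ_pos := A.δ_pos
  core_thick := A.core_thick
  jcore := A.jcore
  jin := A.jin
  jrun := A.jrun
  jcore_nonneg := A.jcore_nonneg
  jcore_lt := A.jcore_lt
  handoff := A.handoff
  floor_cert := A.floor_cert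
  Φ := A.Φ
  τc := A.τc
  τc_nonneg := A.τc_nonneg
  δsh := A.δsh
  δsh_nonneg := A.δsh_nonneg
  dat := A.dat
  unit := A.unit
  unit_pos := A.unit_pos
  clock := A.clock
  shadow := A.shadow
  leak := A.leak
  u₀ := A.u₀
  divFree := A.divFree
  memH10df := A.memH10df
  seed_read := A.seed_read
  seed_junk := A.seed_junk

/-- The derived design reads as the local design. [folklore] -/
@[simp] theorem toShadowedCircuit_read : A.toShadowedCircuit.read = A.read := rfl
/-- The derived design's junk is the local design's. [folklore] -/
@[simp] theorem toShadowedCircuit_junk : A.toShadowedCircuit.junk = A.junk := rfl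
/-- The derived design's circuit is the local design's flow. [folklore] -/
@[simp] theorem toShadowedCircuit_Φ : A.toShadowedCircuit.Φ = A.Φ := rfl
/-- The derived design's input region is the local design's. [folklore] -/
@[simp] theorem toShadowedCircuit_Ain : A.toShadowedCircuit.Ain = A.Ain := rfl
/-- The derived design's tube radius is the local design's. [folklore] -/
@[simp] theorem toShadowedCircuit_δsh : A.toShadowedCircuit.δsh = A.δsh := rfl
/-- The derived design's cycle time is the local design's. [folklore] -/
@[simp] theorem toShadowedCircuit_τc : A.toShadowedCircuit.τc = A.τc := rfl
/-- The derived design's clock is the local design's. [folklore] -/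
@[simp] theorem toShadowedCircuit_unit : A.toShadowedCircuit.unit = A.unit := rfl
/-- The derived design's running threshold is the local design's. [folklore] -/
@[simp] theorem toShadowedCircuit_jrun : A.toShadowedCircuit.jrun = A.jrun := rfl
/-- The derived design's seed is the local design's. [folklore] -/
@[simp] theorem toShadowedCircuit_u₀ : A.toShadowedCircuit.u₀ = A.u₀ := rfl
/-- **The computation is visible, sharply**: in a local design the true readout tracks the circuit to
within `ε (e^{Lσ} - 1)/L` — exponentially SMALL early in the cycle, not merely `≤ δsh` — which is
the quantitative content a `ShadowedCircuit` cannot express. [folklore] -/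
theorem dist_read_le_exp (n : ℕ) (a : L2C) (S' : ℝ) (u : ℝ → L2C)
    (hu : IsMildSolutionFor eulerForm a (Ico 0 S') u) (t : ℝ) (ht : 0 ≤ t)
    (hv : u t ∈ A.toShadowedCircuit.In n)
    (σ : ℝ) (hσ0 : 0 ≤ σ) (hστ : σ ≤ A.τc) (hlt : t + A.unit n * σ < S') :
    dist (A.read n (u (t + A.unit n * σ))) (A.Φ σ (A.read n (u t))) ≤
      A.ε * σ * Real.exp (A.L * σ) :=
  (A.shadow_sharp n a S' u hu t ht hv.1 hv.2 σ hσ0 hστ hlt).trans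
    (BDSV.gronwallBound_zero_le A.L.coe_nonneg A.ε_nonneg)

end LocalCircuit

end Literature.Analysis.FluidPDE.FluidComputer

end
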